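import Summits.KontsevichZagierPeriods.KontsevichZagierPeriods.Theses.TerasomaMultiplication
import Summits.KontsevichZagierPeriods.KontsevichZagierPeriods.Theses.CompiledSubstitutions
import Summits.KontsevichZagierPeriods.KontsevichZagierPeriods.Theorems.BetaCancellation.Negative.LoadBearing
-- (re-add when built on the farm) import Summits.KontsevichZagierPeriods.KontsevichZagierPeriods.Theorems.BetaCancellation.Negative.IntegerExponents
import Literature.NumberTheory.Transcendental.KZProductIdeal
import Literature.NumberTheory.Transcendental.KZMellinFibres
import Literature.NumberTheory.Transcendental.KZRelationsLE
import Literature.NumberTheory.Transcendental.KZLogCalculusProofs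
import Literature.NumberTheory.Transcendental.GammaMonomialsProofs

/-!
# `BetaCancellation` (stmt-KontsevichZagierPeriods-13633) — line `dirichlet-companion-to-pi`

Crux proof skeleton (lead prover). The crux `TerasomaMultiplication.BetaCancellation` (Beta
classes are non-zero-divisors modulo the Kontsevich–Zagier moves, two-term pinned form) is
reduced to registered stubs:

* `stub_piCancellation` — `KZ.PiCancellation` (item stmt-0540, open);
* `stub_eulerReflection` — `CompiledSubstitutions.EulerReflectionRational` (item stmt-3383);
* `stub_betaTranslation` — `(a+b)·[β(a,b+1)] ∼ b·[β(a,b)]` (one Newton–Leibniz move);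
* `stub_dirichletPolar`, `stub_dirichletLinear`, `stub_integrateOut` — the Dirichlet companion
  collapse `[β(ℓ+m,1−m) ⊗ β(ℓ,m)] ∼ [(0,1), ℓ⁻¹ t^{m-1}(1-t)^{-m}]` in three moves (polar chart
  onto the simplex, linear chart back to the box, integrating out the monomial);

composed in `BetaCancellation_of`.
-/

noncomputable section

-- `Summit.KontsevichZagierPeriods.KontsevichZagierPeriods.…` is the tree's mandated layout (single-conjunct summit).
set_option linter.dupNamespace false

namespace Summit.KontsevichZagierPeriods.KontsevichZagierPeriods.BetaCancellationLine

open MeasureTheory Set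
open Literature.NumberTheory.Transcendental
open Literature.NumberTheory.Transcendental.KZ
open Literature.ModelTheory.ExponentialFields (IsSemialgebraic isSemialgebraic_univ)
open MvPolynomial (aeval X C)
open Summit.KontsevichZagierPeriods.KontsevichZagierPeriods.Theses.TerasomaMultiplication
  (BetaCancellation)
open Summit.KontsevichZagierPeriods.KontsevichZagierPeriods.Theses.CompiledSubstitutions
  (EulerReflectionRational)
open Summit.KontsevichZagierPeriods.KontsevichZagierPeriods.BetaCancellationNegative
open Literature.NumberTheory.Transcendental.KZreg (unitIoo isSemialgebraic_unitIoo volume_unitIoo)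

/-! ## Registered stubs -/

/-- STUB (item stmt-KontsevichZagierPeriods-0540, open): `[π]` is a non-zero-divisor modulo the
moves. [folklore] -/
theorem stub_piCancellation : Literature.NumberTheory.Transcendental.KZ.PiCancellation := by
  sorry

/-- STUB (item stmt-KontsevichZagierPeriods-3383): Euler reflection at rational arguments inside
the calculus, `[(0,1), sin(πa) x^{a-1}(1-x)^{-a}] ∼ [disc, 1]`. [folklore] -/
theorem stub_eulerReflection :
    Summit.KontsevichZagierPeriods.KontsevichZagierPeriods.Theses.CompiledSubstitutions.EulerReflectionRational := by
  sorry

/-- STUB: the two-term translation `(a+b)·[β(a,b+1)] ∼ b·[β(a,b)]` (one Newton–Leibniz move with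
primitive `x^a (1-x)^b` plus integrand additivity). [folklore] -/
theorem stub_betaTranslation : ∀ (a b : ℚ), 0 < a → 0 < b →
    ∀ (ρ ρ' : Literature.NumberTheory.Transcendental.KZ.IntegralRep 1),
    ρ.domain = {x | x 0 ∈ Set.Ioo (0:ℝ) 1} →
    Set.EqOn ρ.integrand (fun x => ((a:ℝ) + b) * ((x 0) ^ ((a:ℝ) - 1) * (1 - x 0) ^ (b:ℝ))) ρ.domain →
    ρ'.domain = {x | x 0 ∈ Set.Ioo (0:ℝ) 1} →
    Set.EqOn ρ'.integrand (fun x => (b:ℝ) * ((x 0) ^ ((a:ℝ) - 1) * (1 - x 0) ^ ((b:ℝ) - 1))) ρ'.domain →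
    Literature.NumberTheory.Transcendental.KZ.Equivalent ρ ρ' := by
  sorry

/-- STUB: polar chart `(u,v) ↦ (uv, u(1-v))` of the box onto the open simplex (one rule-2 move):
`[box, u^{ℓ+m-1}(1-u)^{-m} v^{ℓ-1}(1-v)^{m-1}] ∼ [simplex, x^{ℓ-1} y^{m-1} (1-x-y)^{-m}]`. [folklore] -/
theorem stub_dirichletPolar : ∀ (ℓ m : ℚ), 0 < ℓ → 0 < m → m < 1 →
    ∀ (P : Literature.NumberTheory.Transcendental.KZ.IntegralRep 2),
    P.domain = {z | z 0 ∈ Set.Ioo (0:ℝ) 1 ∧ z 1 ∈ Set.Ioo (0:ℝ) 1} →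
    Set.EqOn P.integrand (fun z => (z 0) ^ ((ℓ:ℝ) + m - 1) * (1 - z 0) ^ (-(m:ℝ)) *
      ((z 1) ^ ((ℓ:ℝ) - 1) * (1 - z 1) ^ ((m:ℝ) - 1))) P.domain →
    ∃ S : Literature.NumberTheory.Transcendental.KZ.IntegralRep 2,
      S.domain = {z | 0 < z 0 ∧ 0 < z 1 ∧ z 0 + z 1 < 1} ∧
      Set.EqOn S.integrand (fun z => (z 0) ^ ((ℓ:ℝ) - 1) * (z 1) ^ ((m:ℝ) - 1) *
        (1 - z 0 - z 1) ^ (-(m:ℝ))) S.domain ∧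
      Literature.NumberTheory.Transcendental.KZ.Equivalent P S := by
  sorry

/-- STUB: linear chart `(t,x) ↦ (x, (1-x)t)` of the box onto the open simplex (one rule-2 move):
`[simplex, x^{ℓ-1} y^{m-1} (1-x-y)^{-m}] ∼ [box, t^{m-1}(1-t)^{-m} x^{ℓ-1}]`. [folklore] -/
theorem stub_dirichletLinear : ∀ (ℓ m : ℚ), 0 < ℓ → 0 < m → m < 1 →
    ∀ (S B : Literature.NumberTheory.Transcendental.KZ.IntegralRep 2),
    S.domain = {z | 0 < z 0 ∧ 0 < z 1 ∧ z 0 + z 1 < 1} →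
    Set.EqOn S.integrand (fun z => (z 0) ^ ((ℓ:ℝ) - 1) * (z 1) ^ ((m:ℝ) - 1) *
      (1 - z 0 - z 1) ^ (-(m:ℝ))) S.domain →
    B.domain = {z | z 0 ∈ Set.Ioo (0:ℝ) 1 ∧ z 1 ∈ Set.Ioo (0:ℝ) 1} →
    Set.EqOn B.integrand (fun z => (z 0) ^ ((m:ℝ) - 1) * (1 - z 0) ^ (-(m:ℝ)) *
      (z 1) ^ ((ℓ:ℝ) - 1)) B.domain →
    Literature.NumberTheory.Transcendental.KZ.Equivalent S B := by
  sorry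

/-- STUB: integrating out the monomial (one Newton–Leibniz move along the last coordinate with
primitive `t^{m-1}(1-t)^{-m} x^ℓ/ℓ`): `[box, t^{m-1}(1-t)^{-m} x^{ℓ-1}] ∼ [(0,1), ℓ⁻¹ t^{m-1}(1-t)^{-m}]`.
[folklore] -/
theorem stub_integrateOut : ∀ (ℓ m : ℚ), 0 < ℓ → 0 < m → m < 1 →
    ∀ (B : Literature.NumberTheory.Transcendental.KZ.IntegralRep 2)
      (R : Literature.NumberTheory.Transcendental.KZ.IntegralRep 1),
    B.domain = {z | z 0 ∈ Set.Ioo (0:ℝ) 1 ∧ z 1 ∈ Set.Ioo (0:ℝ) 1} →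
    Set.EqOn B.integrand (fun z => (z 0) ^ ((m:ℝ) - 1) * (1 - z 0) ^ (-(m:ℝ)) *
      (z 1) ^ ((ℓ:ℝ) - 1)) B.domain →
    R.domain = {x | x 0 ∈ Set.Ioo (0:ℝ) 1} →
    Set.EqOn R.integrand (fun x => (ℓ:ℝ)⁻¹ * ((x 0) ^ ((m:ℝ) - 1) * (1 - x 0) ^ (-(m:ℝ)))) R.domain →
    Literature.NumberTheory.Transcendental.KZ.Equivalent B R := by
  sorry

/-! ## Beta representations on `(0,1)` -/

/-- The Mellin family `(X₀, 1 − X₀)` of the Beta kernel on `(0,1) ⊆ ℝ¹`. [folklore] -/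
def betaFamily : Fin 2 → MvPolynomial (Fin 1) ℚ := ![X 0, 1 - X 0]

/-- The Beta kernel is the Euler–Mellin integrand of `betaFamily` with exponents `(a-1, b-1)`.
[folklore] -/
theorem betaKernel_eq_mellinIntegrand (a b : ℚ) (x : Fin 1 → ℝ) :
    betaKernel a b (x 0) = mellinIntegrand betaFamily ![a - 1, b - 1] 1 x := by
  simp [mellinIntegrand, betaFamily, betaKernel, Fin.prod_univ_two]

/-- **`[β(a,b)] = [(0,1), t^{a-1}(1-t)^{b-1}]`** for `0 < a`, `0 < b`. [folklore] -/
def betaRep (a b : ℚ) (ha : 0 < a) (hb : 0 < b) : IntegralRep 1 where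
  domain := unitIoo
  integrand := fun x => betaKernel a b (x 0)
  isSemialgebraic_domain := isSemialgebraic_unitIoo
  isSemialgebraicFunOn_integrand := by
    refine (isSemialgebraicFunOn_mellinIntegrand isSemialgebraic_unitIoo betaFamily ![a - 1, b - 1] 1
      (fun x hx k => ?_)).congr fun x _ => (betaKernel_eq_mellinIntegrand a b x).symm
    simp only [mem_unitIoo, mem_Ioo] at hx
    fin_cases k <;> simp [betaFamily, hx.1, hx.2]
  integrableOn := integrableOn_comp_apply_zero_iff.2 (integrableOn_betaKernel_and_integral_eq ha hb).1

/-- The domain of `betaRep`. [folklore] -/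
@[simp] theorem betaRep_domain (a b : ℚ) (ha : 0 < a) (hb : 0 < b) :
    (betaRep a b ha hb).domain = unitIoo := rfl

/-- The integrand of `betaRep`. [folklore] -/
@[simp] theorem betaRep_integrand (a b : ℚ) (ha : 0 < a) (hb : 0 < b) :
    (betaRep a b ha hb).integrand = fun x => betaKernel a b (x 0) := rfl

/-- `unitIoo` in the crux's spelling. [folklore] -/
theorem unitIoo_eq_setOf : unitIoo = {x : Fin 1 → ℝ | x 0 ∈ Set.Ioo (0:ℝ) 1} := rfl


/-! ## Pinned representations are products -/

/-- `[β(a,b)] × r` is pinned over `r` with the Beta kernel. [folklore] -/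
theorem isPinned_betaRep_prod {n : ℕ} (a b : ℚ) (ha : 0 < a) (hb : 0 < b) (r : IntegralRep n) :
    IsPinned (betaKernel a b) r ((betaRep a b ha hb).prod r) :=
  isPinned_prod (betaRep a b ha hb) rfl (fun _ _ => rfl) r

/-- Two representations pinned with the same kernel over the same base are equivalent (same
domain, integrands agree on it). [folklore] -/
theorem equivalent_of_isPinned_of_isPinned {n : ℕ} {k : ℝ → ℝ} {r : IntegralRep n}
    {q q₂ : IntegralRep (1 + n)} (hq : IsPinned k r q) (hq₂ : IsPinned k r q₂) :
    Equivalent q q₂ := by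
  refine of_sub_of_mem_relations_of_eqOn (hq₂.1.trans hq.1.symm) fun z hz => ?_
  rw [hq.2 hz, hq₂.2 (hq₂.1.symm ▸ hq.1 ▸ hz)]

/-- A representation pinned with the Beta kernel over `r` is equivalent to `[β(a,b)] × r`.
[folklore] -/
theorem equivalent_betaRep_prod_of_isPinned {n : ℕ} {a b : ℚ} (ha : 0 < a) (hb : 0 < b)
    {r : IntegralRep n} {q : IntegralRep (1 + n)} (hq : IsPinned (betaKernel a b) r q) :
    Equivalent q ((betaRep a b ha hb).prod r) :=
  equivalent_of_isPinned_of_isPinned hq (isPinned_betaRep_prod a b ha hb r)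

/-! ## Symmetry `(a,b) ↔ (b,a)`: reflecting the kernel coordinate -/

/-- `[β(a,b)] × r ∼ [β(b,a)] × r`: one rule-2 move `z₀ ↦ 1 − z₀` (`KZ.boxReflection`). [folklore] -/
theorem equivalent_betaRep_prod_swap {n : ℕ} (a b : ℚ) (ha : 0 < a) (hb : 0 < b)
    (r : IntegralRep n) :
    Equivalent ((betaRep a b ha hb).prod r) ((betaRep b a hb ha).prod r) := by
  refine of_sub_of_mem_relations_of_boxReflection (Fin.castAdd n (0 : Fin 1)) ?_ ?_
  · ext z
    simp only [IntegralRep.prod_domain, IntegralRep.mem_prodDomain, betaRep_domain, mem_unitIoo,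
      mem_Ioo, mem_preimage, boxReflection_apply_self]
    have htail : (fun j => boxReflection (Fin.castAdd n (0 : Fin 1)) z (Fin.natAdd 1 j)) =
        fun j => z (Fin.natAdd 1 j) := by
      funext j
      rw [boxReflection_apply_of_ne]
      intro h
      have := congrArg Fin.val h
      simp at this
    rw [htail]
    constructor
    · rintro ⟨⟨h1, h2⟩, h3⟩; exact ⟨⟨by linarith, by linarith⟩, h3⟩
    · rintro ⟨⟨h1, h2⟩, h3⟩; exact ⟨⟨by linarith, by linarith⟩, h3⟩
  · intro z _
    rw [IntegralRep.prod_integrand_eq, IntegralRep.prod_integrand_eq]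
    simp only [IntegralRep.prodFun, betaRep_integrand, boxReflection_apply_self]
    have htail : (fun j => boxReflection (Fin.castAdd n (0 : Fin 1)) z (Fin.natAdd 1 j)) =
        fun j => z (Fin.natAdd 1 j) := by
      funext j
      rw [boxReflection_apply_of_ne]
      intro h
      have := congrArg Fin.val h
      simp at this
    rw [htail, betaKernel_one_sub]

/-- **Symmetry of Beta cancellation**: `KernelCancellation (β(b,a)) → KernelCancellation (β(a,b))`.
[folklore] -/
theorem kernelCancellation_betaKernel_symm {a b : ℚ} (ha : 0 < a) (hb : 0 < b)
    (h : KernelCancellation (betaKernel b a)) : KernelCancellation (betaKernel a b) := by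
  intro n m r r' q q' hq hq' hqq'
  have h1 : Equivalent ((betaRep b a hb ha).prod r) ((betaRep b a hb ha).prod r') :=
    (((equivalent_betaRep_prod_swap a b ha hb r).symm.trans
      (equivalent_betaRep_prod_of_isPinned ha hb hq).symm).trans hqq').trans
      ((equivalent_betaRep_prod_of_isPinned ha hb hq').trans (equivalent_betaRep_prod_swap a b ha hb r'))
  exact h r r' _ _ (isPinned_betaRep_prod b a hb ha r) (isPinned_betaRep_prod b a hb ha r') h1

/-! ## Scaling bookkeeping -/

/-- Rational numbers are algebraic reals. [folklore] -/
theorem isAlgebraic_ratCast (q : ℚ) : IsAlgebraic ℚ ((q : ℚ) : ℝ) := isAlgebraic_algebraMap q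

/-- Scaling twice by inverse constants gives back the representation. [folklore] -/
theorem constMul_constMul_eq {n : ℕ} (r : IntegralRep n) {c : ℝ} (hc : IsAlgebraic ℚ c)
    (hc' : IsAlgebraic ℚ c⁻¹) (hc0 : c ≠ 0) : (r.constMul c hc).constMul c⁻¹ hc' = r := by
  refine IntegralRep.ext' rfl ?_
  funext x
  simp only [IntegralRep.integrand_constMul]
  rw [← mul_assoc, inv_mul_cancel₀ hc0, one_mul]

/-- Cancelling a non-zero algebraic scalar from an equivalence. [folklore] -/
theorem equivalent_of_equivalent_constMul {n m : ℕ} {r : IntegralRep n} {r' : IntegralRep m} {c : ℝ}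
    (hc : IsAlgebraic ℚ c) (hc0 : c ≠ 0) (h : Equivalent (r.constMul c hc) (r'.constMul c hc)) :
    Equivalent r r' := by
  have h' := h.constMul c⁻¹ hc.inv
  rwa [constMul_constMul_eq r hc hc.inv hc0, constMul_constMul_eq r' hc hc.inv hc0] at h'

/-- Scaling the first factor of a product scales the product. [folklore] -/
theorem constMul_prod_eq {l n : ℕ} (t : IntegralRep l) (r : IntegralRep n) {c : ℝ}
    (hc : IsAlgebraic ℚ c) : (t.constMul c hc).prod r = (t.prod r).constMul c hc := by
  refine IntegralRep.ext' rfl ?_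
  rw [IntegralRep.prod_integrand_eq, IntegralRep.integrand_constMul, IntegralRep.prod_integrand_eq]
  funext z
  simp only [IntegralRep.prodFun, IntegralRep.integrand_constMul, mul_assoc]

/-! ## Associativity of the product modulo relations -/

/-- `t × (s × r) ∼ (t × s) × r` (a coordinate relabelling, `KZ.of_sub_of_reindex_mem_relations`).
[folklore] -/
theorem equivalent_prod_assoc {l m n : ℕ} (t : IntegralRep l) (s : IntegralRep m) (r : IntegralRep n) :
    Equivalent (t.prod (s.prod r)) ((t.prod s).prod r) := by
  let e : Fin (l + m + n) ≃ Fin (l + (m + n)) := finCongr (Nat.add_assoc l m n)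
  have key : t.prod (s.prod r) = ((t.prod s).prod r).reindex e := by
    have h1 : ∀ (w : Fin (l + (m + n)) → ℝ) (i : Fin l),
        w (e (Fin.castAdd n (Fin.castAdd m i))) = w (Fin.castAdd (m + n) i) := by
      intro w i; congr 1
    have h2 : ∀ (w : Fin (l + (m + n)) → ℝ) (j : Fin m),
        w (e (Fin.castAdd n (Fin.natAdd l j))) = w (Fin.natAdd l (Fin.castAdd n j)) := by
      intro w j; congr 1
    have h3 : ∀ (w : Fin (l + (m + n)) → ℝ) (j : Fin n),
        w (e (Fin.natAdd (l + m) j)) = w (Fin.natAdd l (Fin.natAdd m j)) := by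
      intro w j; congr 1; ext; simp [e, Nat.add_assoc]
    refine IntegralRep.ext' ?_ ?_
    · ext w
      simp only [IntegralRep.prod_domain, IntegralRep.mem_prodDomain, IntegralRep.reindex_domain,
        mem_setOf_eq, h1, h2, h3]
      exact and_assoc.symm
    · rw [IntegralRep.reindex_integrand, IntegralRep.prod_integrand_eq, IntegralRep.prod_integrand_eq]
      funext w
      simp only [IntegralRep.prodFun, IntegralRep.prod_integrand_eq, h1, h2, h3, mul_assoc]
  rw [key]
  have h := of_sub_of_reindex_mem_relations ((t.prod s).prod r) e
  have h' := relations.neg_mem h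
  simpa [Equivalent] using h'


/-! ## Cast bookkeeping -/

/-- `((a + b : ℚ) : ℝ) - 1 = a + b - 1`. [folklore] -/
theorem cast_add_sub_one (a b : ℚ) : (((a + b : ℚ) : ℝ) - 1) = (a:ℝ) + b - 1 := by push_cast; ring

/-- `((1 - b : ℚ) : ℝ) - 1 = -b`. [folklore] -/
theorem cast_one_sub_sub_one (b : ℚ) : (((1 - b : ℚ) : ℝ) - 1) = -(b:ℝ) := by push_cast; ring

/-- `((b + 1 : ℚ) : ℝ) - 1 = b`. [folklore] -/
theorem cast_add_one_sub_one (b : ℚ) : (((b + 1 : ℚ) : ℝ) - 1) = (b:ℝ) := by push_cast; ring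

/-- `((1 : ℚ) : ℝ) - 1 = 0`. [folklore] -/
theorem cast_one_sub_one : (((1 : ℚ) : ℝ) - 1) = (0:ℝ) := by push_cast; ring

/-- The two coordinates of a point of `ℝ^{1+1}` seen through `Fin.castAdd` / `Fin.natAdd`. [folklore] -/
theorem castAdd_one_zero : (Fin.castAdd 1 (0 : Fin 1) : Fin (1 + 1)) = 0 := rfl

/-- The two coordinates of a point of `ℝ^{1+1}` seen through `Fin.castAdd` / `Fin.natAdd`. [folklore] -/
theorem natAdd_one_zero : (Fin.natAdd 1 (0 : Fin 1) : Fin (1 + 1)) = 1 := rfl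

/-- The domain of a product of two `(0,1)`-representations is the open box, in the stubs' spelling.
[folklore] -/
theorem prod_domain_eq_box (κ β : IntegralRep 1) (hκ : κ.domain = unitIoo) (hβ : β.domain = unitIoo) :
    (κ.prod β).domain = {z : Fin 2 → ℝ | z 0 ∈ Set.Ioo (0:ℝ) 1 ∧ z 1 ∈ Set.Ioo (0:ℝ) 1} := by
  ext z
  simp only [IntegralRep.prod_domain, IntegralRep.mem_prodDomain, hκ, hβ, mem_unitIoo, mem_setOf_eq,
    castAdd_one_zero, natAdd_one_zero]

/-- The integrand of a product of two Beta representations, coordinatewise. [folklore] -/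
theorem betaRep_prod_betaRep_integrand (a b a' b' : ℚ) (ha : 0 < a) (hb : 0 < b) (ha' : 0 < a')
    (hb' : 0 < b') (z : Fin (1 + 1) → ℝ) :
    ((betaRep a b ha hb).prod (betaRep a' b' ha' hb')).integrand z =
      betaKernel a b (z 0) * betaKernel a' b' (z 1) := by
  rw [IntegralRep.prod_integrand_eq]
  simp only [IntegralRep.prodFun, betaRep_integrand, castAdd_one_zero, natAdd_one_zero]

/-! ## The companion collapse `[β(a+b,1−b)] × [β(a,b)] ∼ [(0,1), a⁻¹ t^{b-1}(1-t)^{-b}]` -/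

/-- **Companion collapse** (from `stub_dirichletPolar`, `stub_dirichletLinear`, `stub_integrateOut`):
for `0 < a` and `0 < b < 1`, `[β(a+b,1−b)] × [β(a,b)] ∼ [(0,1), a⁻¹ · t^{b-1}(1-t)^{-b}]`
(value identity `B(a+b,1−b)·B(a,b) = B(b,1−b)/a`). [folklore] -/
theorem companion_collapse {a b : ℚ} (ha : 0 < a) (hb : 0 < b) (hb1 : b < 1) (hab : 0 < a + b)
    (h1b : 0 < 1 - b) :
    Equivalent ((betaRep (a + b) (1 - b) hab h1b).prod (betaRep a b ha hb))
      ((betaRep b (1 - b) hb h1b).constMul (((a:ℚ):ℝ)⁻¹) (isAlgebraic_ratCast a).inv) := by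
  set P := (betaRep (a + b) (1 - b) hab h1b).prod (betaRep a b ha hb) with hP
  have hPd : P.domain = {z : Fin 2 → ℝ | z 0 ∈ Set.Ioo (0:ℝ) 1 ∧ z 1 ∈ Set.Ioo (0:ℝ) 1} :=
    prod_domain_eq_box _ _ rfl rfl
  have hPi : Set.EqOn P.integrand (fun z => (z 0) ^ ((a:ℝ) + b - 1) * (1 - z 0) ^ (-(b:ℝ)) *
      ((z 1) ^ ((a:ℝ) - 1) * (1 - z 1) ^ ((b:ℝ) - 1))) P.domain := by
    intro z _
    rw [hP, betaRep_prod_betaRep_integrand]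
    simp only [betaKernel, cast_add_sub_one, cast_one_sub_sub_one]
  obtain ⟨S, hSd, hSi, hPS⟩ := stub_dirichletPolar a b ha hb hb1 P hPd hPi
  set B := (betaRep b (1 - b) hb h1b).prod (betaRep a 1 ha one_pos) with hB
  have hBd : B.domain = {z : Fin 2 → ℝ | z 0 ∈ Set.Ioo (0:ℝ) 1 ∧ z 1 ∈ Set.Ioo (0:ℝ) 1} :=
    prod_domain_eq_box _ _ rfl rfl
  have hBi : Set.EqOn B.integrand (fun z => (z 0) ^ ((b:ℝ) - 1) * (1 - z 0) ^ (-(b:ℝ)) *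
      (z 1) ^ ((a:ℝ) - 1)) B.domain := by
    intro z _
    rw [hB, betaRep_prod_betaRep_integrand]
    simp only [betaKernel, cast_one_sub_sub_one, cast_one_sub_one, Real.rpow_zero, mul_one]
  have hSB := stub_dirichletLinear a b ha hb hb1 S B hSd hSi hBd hBi
  set R := (betaRep b (1 - b) hb h1b).constMul (((a:ℚ):ℝ)⁻¹) (isAlgebraic_ratCast a).inv with hR
  have hRd : R.domain = {x : Fin 1 → ℝ | x 0 ∈ Set.Ioo (0:ℝ) 1} := rfl
  have hRi : Set.EqOn R.integrand
      (fun x => ((a:ℚ):ℝ)⁻¹ * ((x 0) ^ ((b:ℝ) - 1) * (1 - x 0) ^ (-(b:ℝ)))) R.domain := by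
    intro x _
    simp only [hR, IntegralRep.integrand_constMul, betaRep_integrand, betaKernel, cast_one_sub_sub_one]
  have hBR := stub_integrateOut a b ha hb hb1 B R hBd hBi hRd hRi
  exact hPS.trans (hSB.trans hBR)

/-! ## Euler reflection: `[(0,1), a⁻¹ t^{b-1}(1-t)^{-b}] ∼ (a sin πb)⁻¹ · [π]` -/

/-- `0 < sin(πb)` for `0 < b < 1`. [folklore] -/
theorem sin_pi_mul_pos {b : ℚ} (hb : 0 < b) (hb1 : b < 1) : 0 < Real.sin (Real.pi * b) := by
  have hb' : (0:ℝ) < b := by exact_mod_cast hb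
  have hb1' : (b:ℝ) < 1 := by exact_mod_cast hb1
  refine Real.sin_pos_of_pos_of_lt_pi (by positivity) ?_
  nlinarith [Real.pi_pos]

/-- `sin(πb)` is algebraic for rational `b > 0`. [folklore] -/
theorem isAlgebraic_sin_pi_mul {b : ℚ} (hb : 0 < b) : IsAlgebraic ℚ (Real.sin (Real.pi * b)) := by
  have h := KoblitzOgus.isAlgebraic_sin_rat_mul_pi b.num.toNat b.den_pos
  have hn : ((b.num.toNat : ℕ) : ℝ) = ((b.num : ℤ) : ℝ) := by
    have := Int.toNat_of_nonneg (Rat.num_nonneg.2 hb.le)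
    exact_mod_cast this
  have hcast : (Real.pi * (b.num.toNat : ℕ) / (b.den : ℕ) : ℝ) = Real.pi * b := by
    rw [mul_div_assoc, hn, ← Rat.cast_def]
  rwa [hcast] at h

/-- **Reflection step** (from `stub_eulerReflection`): for `0 < a`, `0 < b < 1`,
`[(0,1), a⁻¹ t^{b-1}(1-t)^{-b}] ∼ (a·sin πb)⁻¹ · [π]`. [folklore] -/
theorem reflection_collapse {a b : ℚ} (ha : 0 < a) (hb : 0 < b) (hb1 : b < 1) (h1b : 0 < 1 - b)
    (hk : IsAlgebraic ℚ ((a:ℝ) * Real.sin (Real.pi * b)))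
    (hk0 : (a:ℝ) * Real.sin (Real.pi * b) ≠ 0) :
    Equivalent ((betaRep b (1 - b) hb h1b).constMul (((a:ℚ):ℝ)⁻¹) (isAlgebraic_ratCast a).inv)
      (piRep.constMul (((a:ℝ) * Real.sin (Real.pi * b))⁻¹) hk.inv) := by
  set R := (betaRep b (1 - b) hb h1b).constMul (((a:ℚ):ℝ)⁻¹) (isAlgebraic_ratCast a).inv with hR
  set E := R.constMul ((a:ℝ) * Real.sin (Real.pi * b)) hk with hE
  have ha0 : ((a:ℚ):ℝ) ≠ 0 := by positivity
  have hEd : E.domain = {x : Fin 1 → ℝ | x 0 ∈ Set.Ioo (0:ℝ) 1} := rfl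
  have hEi : Set.EqOn E.integrand (fun x => Real.sin (Real.pi * b) * (x 0) ^ ((b:ℝ) - 1) *
      (1 - x 0) ^ (-(b:ℝ))) E.domain := by
    intro x _
    simp only [hE, hR, IntegralRep.integrand_constMul, betaRep_integrand, betaKernel,
      cast_one_sub_sub_one]
    field_simp
  have hEpi : Equivalent E piRep :=
    stub_eulerReflection b hb hb1 E piRep hEd hEi rfl (fun _ _ => rfl)
  have h2 := hEpi.constMul ((a:ℝ) * Real.sin (Real.pi * b))⁻¹ hk.inv
  rwa [hE, constMul_constMul_eq R hk hk.inv hk0] at h2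

/-! ## The non-integer regime `0 < b < 1`: companion, reflection, `π`-cancellation -/

/-- **`KernelCancellation (β(a,b))` for `0 < a`, `0 < b < 1`** (companion collapse + Euler
reflection + `KZ.PiCancellation`). [folklore] -/
theorem kernelCancellation_betaKernel_of_lt_one {a b : ℚ} (ha : 0 < a) (hb : 0 < b) (hb1 : b < 1) :
    KernelCancellation (betaKernel a b) := by
  intro n m r r' q q' hq hq' hqq'
  have hab : 0 < a + b := by linarith
  have h1b : 0 < 1 - b := by linarith
  have hk : IsAlgebraic ℚ ((a:ℝ) * Real.sin (Real.pi * b)) :=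
    (isAlgebraic_ratCast a).mul (isAlgebraic_sin_pi_mul hb)
  have hk0 : (a:ℝ) * Real.sin (Real.pi * b) ≠ 0 :=
    mul_ne_zero (by positivity) (sin_pi_mul_pos hb hb1).ne'
  set κ := betaRep (a + b) (1 - b) hab h1b with hκ
  set β := betaRep a b ha hb with hβ
  set Pc := piRep.constMul (((a:ℝ) * Real.sin (Real.pi * b))⁻¹) hk.inv with hPc
  have hcoll : Equivalent (κ.prod β) Pc :=
    (companion_collapse ha hb hb1 hab h1b).trans (reflection_collapse ha hb hb1 h1b hk hk0)
  have chain : ∀ {k : ℕ} (ρ : IntegralRep k) (p : IntegralRep (1 + k)),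
      IsPinned (betaKernel a b) ρ p → Equivalent (κ.prod p) (Pc.prod ρ) := by
    intro k ρ p hp
    exact ((Equivalent.prod (Equivalent.refl κ) (equivalent_betaRep_prod_of_isPinned ha hb hp)).trans
      (equivalent_prod_assoc κ β ρ)).trans (Equivalent.prod hcoll (Equivalent.refl ρ))
  have h1 : Equivalent (Pc.prod r) (Pc.prod r') :=
    ((chain r q hq).symm.trans (Equivalent.prod (Equivalent.refl κ) hqq')).trans (chain r' q' hq')
  have h2 : Equivalent (piRep.prod r) (piRep.prod r') := by
    refine equivalent_of_equivalent_constMul hk.inv (inv_ne_zero hk0) ?_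
    rw [← constMul_prod_eq, ← constMul_prod_eq]
    exact h1
  have h3 : of piRep * (of r - of r') ∈ relations := by
    rw [mul_sub, of_mul_of, of_mul_of]
    exact h2
  exact stub_piCancellation _ h3

/-! ## Translation `b ↦ b + 1` -/

/-- **`KernelCancellation (β(a,b)) → KernelCancellation (β(a,b+1))`** (from `stub_betaTranslation`:
`(a+b)·[β(a,b+1)] ∼ b·[β(a,b)]`, and scalars cancel). [folklore] -/
theorem kernelCancellation_betaKernel_succ {a b : ℚ} (ha : 0 < a) (hb : 0 < b)
    (h : KernelCancellation (betaKernel a b)) : KernelCancellation (betaKernel a (b + 1)) := by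
  intro n m r r' q q' hq hq' hqq'
  have hb1 : 0 < b + 1 := by linarith
  have hab : IsAlgebraic ℚ ((a:ℝ) + b) := by
    have := isAlgebraic_ratCast (a + b)
    push_cast at this
    exact this
  have hbalg : IsAlgebraic ℚ ((b:ℚ):ℝ) := isAlgebraic_ratCast b
  have hb0 : ((b:ℚ):ℝ) ≠ 0 := by positivity
  set ρ := (betaRep a (b + 1) ha hb1).constMul ((a:ℝ) + b) hab with hρ
  set ρ' := (betaRep a b ha hb).constMul ((b:ℚ):ℝ) hbalg with hρ'
  have hρρ' : Equivalent ρ ρ' := by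
    refine stub_betaTranslation a b ha hb ρ ρ' rfl (fun x _ => ?_) rfl (fun x _ => ?_)
    · simp only [hρ, IntegralRep.integrand_constMul, betaRep_integrand, betaKernel, cast_add_one_sub_one]
    · simp only [hρ', IntegralRep.integrand_constMul, betaRep_integrand, betaKernel]
  have chain : ∀ {k : ℕ} (σ : IntegralRep k) (p : IntegralRep (1 + k)),
      IsPinned (betaKernel a (b + 1)) σ p →
      Equivalent (p.constMul ((a:ℝ) + b) hab) (((betaRep a b ha hb).prod σ).constMul ((b:ℚ):ℝ) hbalg) := by
    intro k σ p hp
    have e1 := (equivalent_betaRep_prod_of_isPinned ha hb1 hp).constMul ((a:ℝ) + b) hab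
    rw [← constMul_prod_eq] at e1
    have e2 : Equivalent (ρ.prod σ) (ρ'.prod σ) := Equivalent.prod hρρ' (Equivalent.refl σ)
    rw [hρ', constMul_prod_eq (betaRep a b ha hb) σ hbalg] at e2
    exact e1.trans e2
  have h1 := ((chain r q hq).symm.trans (hqq'.constMul _ hab)).trans (chain r' q' hq')
  have h2 := equivalent_of_equivalent_constMul hbalg hb0 h1
  exact h r r' _ _ (isPinned_betaRep_prod a b ha hb r) (isPinned_betaRep_prod a b ha hb r') h2

/-- Iterated translation. [folklore] -/
theorem kernelCancellation_betaKernel_add_nat {a b : ℚ} (ha : 0 < a) (hb : 0 < b)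
    (h : KernelCancellation (betaKernel a b)) (k : ℕ) : KernelCancellation (betaKernel a (b + k)) := by
  induction k with
  | zero => simpa using h
  | succ k ih =>
    have := kernelCancellation_betaKernel_succ ha (by positivity) ih
    push_cast
    rwa [← add_assoc]

/-- Every positive rational is `b₀ + k` with `b₀ ∈ (0,1]` and `k ∈ ℕ`. [folklore] -/
theorem exists_frac_add_nat {b : ℚ} (hb : 0 < b) :
    ∃ (b₀ : ℚ) (k : ℕ), 0 < b₀ ∧ b₀ ≤ 1 ∧ b = b₀ + k := by
  have h1 : (1:ℤ) ≤ ⌈b⌉ := Int.one_le_ceil_iff.2 hb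
  have h2 : (((⌈b⌉ - 1).toNat : ℕ) : ℚ) = ((⌈b⌉ : ℤ) : ℚ) - 1 := by
    have := Int.toNat_of_nonneg (sub_nonneg.2 h1)
    exact_mod_cast this
  refine ⟨b - ((⌈b⌉ - 1).toNat : ℕ), (⌈b⌉ - 1).toNat, ?_, ?_, by ring⟩
  · rw [h2]
    have := Int.ceil_lt_add_one b
    linarith
  · rw [h2]
    have := Int.le_ceil b
    linarith

/-- `KernelCancellation (β(1,a))` for every rational `a > 0`. [folklore] -/
theorem kernelCancellation_betaKernel_one_left {a : ℚ} (ha : 0 < a) : KernelCancellation (betaKernel 1 a) := by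
  obtain ⟨a₀, k, h0, h1, rfl⟩ := exists_frac_add_nat ha
  refine kernelCancellation_betaKernel_add_nat one_pos h0 ?_ k
  rcases h1.lt_or_eq with h1 | rfl
  · exact kernelCancellation_betaKernel_of_lt_one one_pos h0 h1
  · exact kernelCancellation_betaKernel_one_one

/-- `KernelCancellation (β(a,b₀))` for `0 < a` and `b₀ ∈ (0,1]`. [folklore] -/
theorem kernelCancellation_betaKernel_base {a b₀ : ℚ} (ha : 0 < a) (h0 : 0 < b₀) (h1 : b₀ ≤ 1) :
    KernelCancellation (betaKernel a b₀) := by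
  rcases h1.lt_or_eq with h1 | rfl
  · exact kernelCancellation_betaKernel_of_lt_one ha h0 h1
  · exact kernelCancellation_betaKernel_symm ha one_pos (kernelCancellation_betaKernel_one_left ha)

/-- **`KernelCancellation (β(a,b))` for all positive rationals `a, b`.** [folklore] -/
theorem kernelCancellation_betaKernel_of_pos {a b : ℚ} (ha : 0 < a) (hb : 0 < b) :
    KernelCancellation (betaKernel a b) := by
  obtain ⟨b₀, k, h0, h1, rfl⟩ := exists_frac_add_nat hb
  exact kernelCancellation_betaKernel_add_nat ha h0 (kernelCancellation_betaKernel_base ha h0 h1) k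

/-! ## The crux -/

/-- **Line `dirichlet-companion-to-pi` closes the crux**: `BetaCancellation` from the registered
stubs (`stub_piCancellation`, `stub_eulerReflection`, `stub_betaTranslation`, `stub_dirichletPolar`,
`stub_dirichletLinear`, `stub_integrateOut`). [folklore] -/
theorem BetaCancellation_of :
    Summit.KontsevichZagierPeriods.KontsevichZagierPeriods.Theses.TerasomaMultiplication.BetaCancellation :=
  betaCancellation_iff.2 fun _ _ ha hb => kernelCancellation_betaKernel_of_pos ha hb

end Summit.KontsevichZagierPeriods.KontsevichZagierPeriods.BetaCancellationLine
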